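import Summits.CriticalPhenomena.PercolationContinuityZ3.Theorems.PercNearOneGluingNoHeavyLowerTailSahiPolyReflect
import HarnessLib

/-!
# `NoHeavyLowerTail` (stmt-CriticalPhenomena-4575) — reflective identity checker, FAST zero test (sorted list keys)

Support file, seat `prim-l12-p5` (gen 9), `--supports stmt-CriticalPhenomena-4575`.  Standard axioms; computable list operations; no sorries.
`…SahiPolyReflect.isZeroL` merges equal exponents by a quadratic scan with function-equality tests on `Fin k → ℕ` closures, which is too slow in compiled code for
the ≈ 13 000-term order-6 bridge (> 700 s).  Here the exponent vectors are converted once to `List ℕ` keys (`toKL`), the keyed terms are SORTED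
(`List.mergeSort`, a permutation — `List.mergeSort_perm`) and equal ADJACENT keys are merged (`mergeAdj`); `isZeroFast` tests that all merged coefficients vanish.
Soundness: `evalKL_toKL`, `evalKL_perm`, `evalKL_mergeAdj`, **`evalLV_eq_of_isZeroFast`**. [this work; folklore (proof by reflection)]
-/

namespace Summit.CriticalPhenomena.PercolationContinuityZ3.Theorems

namespace SahiHitting

open Finset

variable {k : ℕ}

/-- Keyed terms: coefficient and exponent LIST. [folklore] -/
def toKL (L : List (ℤ × (Fin k → ℕ))) : List (ℤ × List ℕ) := L.map fun t => (t.1, List.ofFn t.2)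

/-- Evaluation of keyed terms in `k` variables (missing exponents read as `0`). [folklore] -/
noncomputable def evalKL (k : ℕ) (L : List (ℤ × List ℕ)) (x : Fin k → ℝ) : ℝ :=
  (L.map fun t => (t.1 : ℝ) * ∏ i : Fin k, x i ^ t.2.getD i.1 0).sum

/-- `evalLV` as a mapped sum. [folklore] -/
theorem evalLV_eq_sum_map (L : List (ℤ × (Fin k → ℕ))) (x : Fin k → ℝ) :
    evalLV L x = (L.map fun t => (t.1 : ℝ) * ∏ i, x i ^ t.2 i).sum := by
  induction L with
  | nil => rfl
  | cons t ts ih => rw [evalLV_cons, ih, List.map_cons, List.sum_cons]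

/-- Conversion to keys preserves the evaluation. [folklore] -/
theorem evalKL_toKL (L : List (ℤ × (Fin k → ℕ))) (x : Fin k → ℝ) : evalKL k (toKL L) x = evalLV L x := by
  rw [evalLV_eq_sum_map, evalKL, toKL, List.map_map]
  congr 1
  refine List.map_congr_left fun t _ => ?_
  simp only [Function.comp]
  congr 1
  refine Finset.prod_congr rfl fun i _ => ?_
  rw [List.getD_eq_getElem?_getD, List.getElem?_ofFn]
  simp

/-- Evaluation is invariant under permutations of the term list. [folklore] -/
theorem evalKL_perm {L M : List (ℤ × List ℕ)} (h : L.Perm M) (x : Fin k → ℝ) : evalKL k L x = evalKL k M x := by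
  unfold evalKL; exact (h.map _).sum_eq

/-- Merge a running term into the list, adding coefficients while the keys agree (structural recursion). [folklore] -/
def mergeAux (t : ℤ × List ℕ) : List (ℤ × List ℕ) → List (ℤ × List ℕ)
  | [] => [t]
  | s :: rest => if t.2 = s.2 then mergeAux (t.1 + s.1, t.2) rest else t :: mergeAux s rest

/-- Merge adjacent terms with equal keys. [folklore] -/
def mergeAdj : List (ℤ × List ℕ) → List (ℤ × List ℕ)
  | [] => []
  | t :: rest => mergeAux t rest

/-- Soundness of `mergeAux`. [folklore] -/
theorem evalKL_mergeAux (t : ℤ × List ℕ) (rest : List (ℤ × List ℕ)) (x : Fin k → ℝ) :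
    evalKL k (mergeAux t rest) x = evalKL k (t :: rest) x := by
  induction rest generalizing t with
  | nil => rfl
  | cons s ss ih =>
    by_cases h : t.2 = s.2
    · rw [mergeAux, if_pos h, ih]
      simp only [evalKL, List.map_cons, List.sum_cons, h]
      push_cast; ring
    · rw [mergeAux, if_neg h]
      simp only [evalKL, List.map_cons, List.sum_cons] at ih ⊢
      rw [ih]

/-- Merging adjacent equal keys preserves the evaluation. [folklore] -/
theorem evalKL_mergeAdj (L : List (ℤ × List ℕ)) (x : Fin k → ℝ) : evalKL k (mergeAdj L) x = evalKL k L x := by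
  cases L with
  | nil => rfl
  | cons t rest => exact evalKL_mergeAux t rest x

/-- The fast zero test: sort by key, merge adjacent, all coefficients zero. [folklore] -/
def isZeroFast (L : List (ℤ × (Fin k → ℕ))) : Bool :=
  (mergeAdj ((toKL L).mergeSort fun a b => decide (a.2 ≤ b.2))).all fun t => t.1 == 0

/-- Soundness of `isZeroFast`. [folklore] -/
theorem evalLV_eq_zero_of_isZeroFast (L : List (ℤ × (Fin k → ℕ))) (h : isZeroFast L = true) (x : Fin k → ℝ) : evalLV L x = 0 := by
  rw [← evalKL_toKL, evalKL_perm (List.mergeSort_perm (toKL L) fun a b => decide (a.2 ≤ b.2)).symm, ← evalKL_mergeAdj]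
  rw [isZeroFast, List.all_eq_true] at h
  generalize hC : mergeAdj ((toKL L).mergeSort fun a b => decide (a.2 ≤ b.2)) = C at h
  clear hC
  unfold evalKL
  induction C with
  | nil => rfl
  | cons t ts ih =>
    have ht : t.1 = 0 := by simpa using h t (by simp)
    rw [List.map_cons, List.sum_cons, ht, ih (fun s hs => h s (by simp [hs]))]
    push_cast; ring

/-- **Reflective identity check (fast)**: `isZeroFast (L ++ pnegL M)` certifies `evalLV L x = evalLV M x`. [folklore] -/
theorem evalLV_eq_of_isZeroFast (L M : List (ℤ × (Fin k → ℕ))) (h : isZeroFast (L ++ pnegL M) = true) (x : Fin k → ℝ) :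
    evalLV L x = evalLV M x := by
  have h0 := evalLV_eq_zero_of_isZeroFast _ h x
  rw [evalLV_append, evalLV_pnegL] at h0
  linarith

/-- Self-test (`native_decide`): `(x₀+x₁)² − (x₀²+2x₀x₁+x₁²)` passes the fast zero test. [this work] -/
theorem test_isZeroFast : isZeroFast (pmulL testLin testLin ++ pnegL testSq) = true := by
  native_decide

end SahiHitting

end Summit.CriticalPhenomena.PercolationContinuityZ3.Theorems
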